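import Summits.HubbardSuperconductivity.HubbardSuperconductivity.Theses.DeformationLadder
import Literature.MathematicalPhysics.QuantumLattice.MagneticHubbardTorusPeierls
import Literature.MathematicalPhysics.QuantumLattice.FinDimSpectrumSectorGibbsLimit

/-!
# Crux `LowEnergyRigidity` (route `DeformationLadder`): the gauge orbit — diamagnetic pricing,
# ironing, and the Bloch margin

Support file for the crux item stmt-HubbardSuperconductivity-1892
(`Summit.HubbardSuperconductivity.HubbardSuperconductivity.Theses.DeformationLadder.LowEnergyRigidity`),
first lemmas of the crux idea `gauge-orbit-ironing` (crux-ideate round 1, ideator 2;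
`Cruxes/LowEnergyRigidity/Ideas/gauge-orbit-ironing.md`, `Cruxes/LowEnergyRigidity/SketchIdeator2.lean`).
All five first lemmas typed in that sketch are PROVED here, with the sketch's abbreviations
`hop L x i σ := c†_{x+eᵢ,σ} c_{x,σ}` and `pureGauge L θ := gaugeTransform (e^{iθ}) 1` unfolded:

* (engine, Literature `MagneticHubbardTorusPeierls`) the bond-by-bond unfolding of the Peierls
  Hamiltonian in expectation: `Re⟨φ, H_A φ⟩ = Re⟨φ, H_1 φ⟩ + Σ_{x,i,σ} [2(1 − Re a_{x,i}) Re h + 2 Im a_{x,i} · Im h]`,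
  `h = h_{x,i,σ}(φ) = ⟨φ, c†_{x+eᵢ,σ} c_{x,σ} φ⟩` (bond kinetic weight `2 Re h`, bond current `−2 Im h`);
* `diamagneticPricing` — the sketch's MASTER FIRST LEMMA `DiamagneticPricing`: for every lattice
  `U(1)` field `A` and every unit sector vector `φ`,
  `[E₀(H_A) − E₀(H)] + Σ [−2(1 − Re a) Re h − 2 Im a · Im h] ≤ Re⟨φ,Hφ⟩ − E₀(H)` (sector energies
  `Matrix.minEnergyOn · (szSector N M)`; it is the variational principle for `H_A` with `φ` itself as
  trial vector);
* `pureGauge_isospectral` — the sketch's `PureGaugeIsospectral` (pure gauges `dθ` have the sector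
  energies of `hubbardTorus 2 L 1 U`; from the Literature gauge covariance
  `minEnergyOn_szSector_gaugeTransform_one`);
* `ironing_variational`, `ironing_lowerBound` — the sketch's `IroningVariational` / `IroningLowerBound`
  (price a state with the pure gauge `d(sθ)`: `Σ [−2(1 − cos(s δθ)) Re h − 2 sin(s δθ) Im h] ≤ Re⟨φ,Hφ⟩ − E₀`);
* `blochMargin`, `blochMargin'` — the sketch's `BlochMargin` (uniform twist `e^{∓iΦ/L}` on the
  `e₁`-bonds, priced against the flux landscape `fluxEnergy L U δ Φ − fluxEnergy L U δ 0` of route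
  `FluxSpectroscopy` through `fluxEnergy_eq_minEnergyOn_uniformTwistConfig` and `fluxEnergy_neg`), and
  `sqrt_sq_add_sq_sub_le_of_fluxDeficit` — its optimisation over the twist ("current costs energy
  quadratically up to the paramagnetic deficit").

Bloch's theorem proper (integer flux quanta are pure gauges; sector ground states carry `O(K/L)`
current) is the Literature companion `HubbardTorusBlochCurrentBound.lean`; the Bloch bound on the
flux envelope `E^T(θ) ≤ E^T(0) + 2θ²` is `HubbardTorusFluxBlochBound.lean`.

Sources: F. Bloch / D. Bohm, Phys. Rev. 75 (1949) 502 (variational twist); H. Watanabe, J. Stat.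
Phys. 177 (2019) 717 §2.2; Y. Tada, T. Koma, J. Stat. Phys. 165 (2016) 455 §2; E. H. Lieb, PRL 73
(1994) 2158 (Peierls phases, gauge invariance). No definitions are introduced; nothing here is
specific to `d`-wave order — these are the identity-level inequalities every line through the
gauge orbit starts from.
-/

noncomputable section

namespace Summit.HubbardSuperconductivity.HubbardSuperconductivity.Theorems.LowEnergyRigidity.GaugeOrbit

set_option linter.dupNamespace false -- summit = problem name (single-conjunct summit), D-0017

open Matrix Finset
open scoped ComplexConjugate
open Literature.MathematicalPhysics.QuantumLattice Literature.MathematicalPhysics.QuantumFieldTheory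
  Literature.Probability.LatticeModels

variable {L : ℕ} [NeZero L]

omit [NeZero L] in
/-- The Hubbard torus (`t = 1`) is Hermitian (unconditionally: `LiebThm1.hamiltonian_isHermitian`).
[folklore] -/
theorem isHermitian_hubbardTorus_one (U : ℝ) : (hubbardTorus 2 L 1 U).IsHermitian :=
  LiebThm1.hamiltonian_isHermitian _ 1 U

/-! ### Diamagnetic pricing (the master first lemma) -/

/-- **Diamagnetic pricing** (`DiamagneticPricing` of the sketch, with `hop` unfolded): for every
`L ≥ 3`, every lattice `U(1)` gauge field `A` and every unit vector `φ` of the joint sector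
`(N, S^z = M)`,
`[E₀(H_A) − E₀(H)] + Σ_{x,i,σ} [−2(1 − Re a_{x,i}) Re h_{x,i,σ}(φ) − 2 Im a_{x,i} · Im h_{x,i,σ}(φ)]
≤ Re⟨φ, H φ⟩ − E₀(H)`, `H = hubbardTorus 2 L 1 U`, `E₀ = minEnergyOn · (szSector N M)`. It is the
variational principle `E₀(H_A) ≤ ⟨φ, H_A φ⟩` unfolded bond by bond. Bloch/Bohm (1949); Watanabe
(2019) §2.2.1; Tada–Koma (2016) §2. -/
theorem diamagneticPricing (hL : 3 ≤ L) (U : ℝ) (N : ℕ) (M : ℝ) (A : GaugeConfig 2 L Circle)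
    (φ : Fock (Orb (FermionTorus 2 L))) (hφ : φ ∈ szSector N M) (h1 : star φ ⬝ᵥ φ = 1) :
    ((magneticHubbardTorus L A 1 U).minEnergyOn (szSector N M) -
        (hubbardTorus 2 L 1 U).minEnergyOn (szSector N M)) +
      (∑ x : Site 2 L, ∑ i : Fin 2, ∑ σ : Fin 2,
        (-2 * (1 - ((A (x, i) : Circle) : ℂ).re) *
            (star φ ⬝ᵥ ((creation (orb (FermionTorus.ofTorusSite (Site.shift x i)) σ) *
              annihilation (orb (FermionTorus.ofTorusSite x) σ)) *ᵥ φ)).re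
          - 2 * ((A (x, i) : Circle) : ℂ).im *
            (star φ ⬝ᵥ ((creation (orb (FermionTorus.ofTorusSite (Site.shift x i)) σ) *
              annihilation (orb (FermionTorus.ofTorusSite x) σ)) *ᵥ φ)).im)) ≤
      (star φ ⬝ᵥ (hubbardTorus 2 L 1 U *ᵥ φ)).re -
        (hubbardTorus 2 L 1 U).minEnergyOn (szSector N M) := by
  have hvar : (magneticHubbardTorus L A 1 U).minEnergyOn (szSector N M) ≤
      (star φ ⬝ᵥ (magneticHubbardTorus L A 1 U *ᵥ φ)).re :=
    minEnergyOn_le_rayleigh_of_mem (magneticHubbardTorus_isHermitian A 1 U) _ hφ h1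
  have hexp := re_star_dotProduct_magneticHubbardTorus_mulVec A U φ
  rw [magneticHubbardTorus_one_eq_hubbardTorus hL] at hexp
  have hsum : (∑ x : Site 2 L, ∑ i : Fin 2, ∑ σ : Fin 2,
        (-2 * (1 - ((A (x, i) : Circle) : ℂ).re) *
            (star φ ⬝ᵥ ((creation (orb (FermionTorus.ofTorusSite (Site.shift x i)) σ) *
              annihilation (orb (FermionTorus.ofTorusSite x) σ)) *ᵥ φ)).re
          - 2 * ((A (x, i) : Circle) : ℂ).im *
            (star φ ⬝ᵥ ((creation (orb (FermionTorus.ofTorusSite (Site.shift x i)) σ) *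
              annihilation (orb (FermionTorus.ofTorusSite x) σ)) *ᵥ φ)).im)) =
      -(∑ x : Site 2 L, ∑ i : Fin 2, ∑ σ : Fin 2,
          (2 * (1 - ((A (x, i) : Circle) : ℂ).re) *
              (star φ ⬝ᵥ ((creation (orb (FermionTorus.ofTorusSite (Site.shift x i)) σ) *
                annihilation (orb (FermionTorus.ofTorusSite x) σ)) *ᵥ φ)).re +
            2 * ((A (x, i) : Circle) : ℂ).im *
              (star φ ⬝ᵥ ((creation (orb (FermionTorus.ofTorusSite (Site.shift x i)) σ) *
                annihilation (orb (FermionTorus.ofTorusSite x) σ)) *ᵥ φ)).im)) := by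
    simp only [← Finset.sum_neg_distrib]
    refine Finset.sum_congr rfl fun x _ => Finset.sum_congr rfl fun i _ =>
      Finset.sum_congr rfl fun σ _ => ?_
    ring
  rw [hsum]
  linarith

/-! ### Pure gauges: isospectrality and ironing -/

/-- **Pure gauges are isospectral** (`PureGaugeIsospectral` of the sketch, `pureGauge L θ =
gaugeTransform (e^{iθ}) 1` unfolded): for `L ≥ 3` the torus in the pure-gauge field
`(x,i) ↦ e^{i(θ_x − θ_{x+eᵢ})}` has, in every joint sector `(N, S^z = M)`, the sector energy of
`hubbardTorus 2 L 1 U` (`H_{dθ} = W_θᴴ H W_θ` with the sector-preserving site-phase unitary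
`W_θ = phaseGauge e^{iθ}`). Lieb, PRL 73 (1994) 2158; Koma–Tasaki, PRL 68 (1992) 3248, eqs. (5)–(8). -/
theorem pureGauge_isospectral (hL : 3 ≤ L) (U : ℝ) (N : ℕ) (M : ℝ) (θ : Site 2 L → ℝ) :
    (magneticHubbardTorus L (gaugeTransform (fun x => Circle.exp (θ x)) 1) 1 U).minEnergyOn
        (szSector N M) =
      (hubbardTorus 2 L 1 U).minEnergyOn (szSector N M) :=
  minEnergyOn_szSector_gaugeTransform_one hL _ 1 U N M

/-- **Ironing, variational half** (`IroningVariational` of the sketch): for every real site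
function `θ`, the sector ground energy of the PURE model is bounded above by the `H_{dθ}`-energy of
any unit sector vector `φ`. Bloch/Bohm (1949); Watanabe (2019) §2.2.1. -/
theorem ironing_variational (hL : 3 ≤ L) (U : ℝ) (N : ℕ) (M : ℝ) (θ : Site 2 L → ℝ)
    (φ : Fock (Orb (FermionTorus 2 L))) (hφ : φ ∈ szSector N M) (h1 : star φ ⬝ᵥ φ = 1) :
    (hubbardTorus 2 L 1 U).minEnergyOn (szSector N M) ≤
      (star φ ⬝ᵥ (magneticHubbardTorus L (gaugeTransform (fun x => Circle.exp (θ x)) 1) 1 U *ᵥ φ)).re := by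
  rw [← pureGauge_isospectral hL U N M θ]
  exact minEnergyOn_le_rayleigh_of_mem (magneticHubbardTorus_isHermitian _ 1 U) _ hφ h1

omit [NeZero L] in
/-- The Peierls factor of the pure gauge `d(sθ)` on the edge `(x, x+eᵢ)` is `e^{is(θ_x − θ_{x+eᵢ})}`.
[folklore] -/
theorem coe_gaugeTransform_exp_one (s : ℝ) (θ : Site 2 L → ℝ) (x : Site 2 L) (i : Fin 2) :
    ((gaugeTransform (fun y => Circle.exp (s * θ y)) (1 : GaugeConfig 2 L Circle) (x, i) : Circle) : ℂ) =
      Complex.exp (((s * (θ x - θ (Site.shift x i)) : ℝ) : ℂ) * Complex.I) := by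
  rw [gaugeTransform, Pi.one_apply, mul_one, ← Circle.exp_neg, ← Circle.exp_add, Circle.coe_exp]
  congr 2
  push_cast
  ring

/-- **Ironing lower bound** (`IroningLowerBound` of the sketch): for every unit sector vector `φ`,
every real `θ` and every amplitude `s`, with `h_{x,i,σ}(φ) = ⟨φ, c†_{x+eᵢ,σ}c_{x,σ} φ⟩` and
`δθ_{x,i} = θ_x − θ_{x+eᵢ}`,
`Σ_{x,i,σ} [−2(1 − cos(s δθ_{x,i})) Re h − 2 sin(s δθ_{x,i}) Im h] ≤ Re⟨φ,Hφ⟩ − E₀`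
(diamagnetic pricing with the pure gauge `d(sθ)`, whose landscape term vanishes by
`pureGauge_isospectral`). Bloch/Bohm (1949); Watanabe (2019) §2.2.1; Tada–Koma (2016) §2. -/
theorem ironing_lowerBound (hL : 3 ≤ L) (U : ℝ) (N : ℕ) (M : ℝ) (θ : Site 2 L → ℝ) (s : ℝ)
    (φ : Fock (Orb (FermionTorus 2 L))) (hφ : φ ∈ szSector N M) (h1 : star φ ⬝ᵥ φ = 1) :
    (∑ x : Site 2 L, ∑ i : Fin 2, ∑ σ : Fin 2,
        (-2 * (1 - Real.cos (s * (θ x - θ (Site.shift x i)))) *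
            (star φ ⬝ᵥ ((creation (orb (FermionTorus.ofTorusSite (Site.shift x i)) σ) *
              annihilation (orb (FermionTorus.ofTorusSite x) σ)) *ᵥ φ)).re
          - 2 * Real.sin (s * (θ x - θ (Site.shift x i))) *
            (star φ ⬝ᵥ ((creation (orb (FermionTorus.ofTorusSite (Site.shift x i)) σ) *
              annihilation (orb (FermionTorus.ofTorusSite x) σ)) *ᵥ φ)).im)) ≤
      (star φ ⬝ᵥ (hubbardTorus 2 L 1 U *ᵥ φ)).re -
        (hubbardTorus 2 L 1 U).minEnergyOn (szSector N M) := by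
  have h := diamagneticPricing hL U N M (gaugeTransform (fun y => Circle.exp (s * θ y)) 1) φ hφ h1
  rw [minEnergyOn_szSector_gaugeTransform_one hL, sub_self, zero_add] at h
  simpa only [coe_gaugeTransform_exp_one, Complex.exp_ofReal_mul_I_re, Complex.exp_ofReal_mul_I_im]
    using h

/-! ### Uniform twists: pricing in a general sector -/

/-- Bookkeeping: `Σ_x [(−2c R₀ − 2d I₀) + (−2c R₁ − 2d I₁)] = −c Σ_x (2R₀ + 2R₁) − d Σ_x (2I₀ + 2I₁)`.
[folklore] -/
private theorem sum_pricing_rearrange {ι : Type*} (s : Finset ι) (c d : ℝ) (R₀ I₀ R₁ I₁ : ι → ℝ) :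
    ∑ x ∈ s, ((-2 * c * R₀ x - 2 * d * I₀ x) + (-2 * c * R₁ x - 2 * d * I₁ x)) =
      -c * ∑ x ∈ s, (2 * R₀ x + 2 * R₁ x) - d * ∑ x ∈ s, (2 * I₀ x + 2 * I₁ x) := by
  rw [Finset.mul_sum, Finset.mul_sum, ← Finset.sum_sub_distrib]
  exact Finset.sum_congr rfl fun x _ => by ring

/-- **Uniform-twist pricing** in a general joint sector `(N, S^z = M)`: for every unit sector vector
`φ` and every total twist `Φ` (phase `e^{iΦ/L}` on each `e₁`-bond),
`[E₀(H_{twist Φ}) − E₀(H)] − (1 − cos(Φ/L)) K(φ) − sin(Φ/L) J̃(φ) ≤ Re⟨φ,Hφ⟩ − E₀(H)`, where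
`K(φ) = Σ_{x,σ} 2 Re h_{x,0,σ}(φ)` is the `e₁`-kinetic weight and `J̃(φ) = Σ_{x,σ} 2 Im h_{x,0,σ}(φ)`
(minus the total `e₁`-current), `h_{x,0,σ}(φ) = ⟨φ, c†_{x+e₁,σ}c_{x,σ} φ⟩` (diamagnetic pricing with
`A = uniformTwistConfig L Φ`; the `e₂`-bonds carry no phase). Bloch/Bohm (1949); Watanabe (2019) §2.2.1. -/
theorem uniformTwist_pricing (hL : 3 ≤ L) (U : ℝ) (N : ℕ) (M : ℝ) (Φ : ℝ)
    (φ : Fock (Orb (FermionTorus 2 L))) (hφ : φ ∈ szSector N M) (h1 : star φ ⬝ᵥ φ = 1) :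
    ((magneticHubbardTorus L (uniformTwistConfig L Φ) 1 U).minEnergyOn (szSector N M) -
        (hubbardTorus 2 L 1 U).minEnergyOn (szSector N M))
      - (1 - Real.cos (Φ / L)) *
          (∑ x : Site 2 L, ∑ σ : Fin 2, 2 * (star φ ⬝ᵥ ((creation
            (orb (FermionTorus.ofTorusSite (Site.shift x 0)) σ) *
              annihilation (orb (FermionTorus.ofTorusSite x) σ)) *ᵥ φ)).re)
      - Real.sin (Φ / L) *
          (∑ x : Site 2 L, ∑ σ : Fin 2, 2 * (star φ ⬝ᵥ ((creation
            (orb (FermionTorus.ofTorusSite (Site.shift x 0)) σ) *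
              annihilation (orb (FermionTorus.ofTorusSite x) σ)) *ᵥ φ)).im) ≤
      (star φ ⬝ᵥ (hubbardTorus 2 L 1 U *ᵥ φ)).re -
        (hubbardTorus 2 L 1 U).minEnergyOn (szSector N M) := by
  have h := diamagneticPricing hL U N M (uniformTwistConfig L Φ) φ hφ h1
  have hcoe : ∀ x : Site 2 L, ((uniformTwistConfig L Φ (x, 0) : Circle) : ℂ) =
      Complex.exp (((Φ / L : ℝ) : ℂ) * Complex.I) := fun x => by
    rw [uniformTwistConfig_apply, if_pos rfl, Circle.coe_exp]
  have hone : ∀ x : Site 2 L, ((uniformTwistConfig L Φ (x, 1) : Circle) : ℂ) = 1 := fun x => by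
    rw [uniformTwistConfig_apply, if_neg (by decide), Circle.coe_one]
  -- expand the sums over `i : Fin 2` (the `e₂`-terms vanish) and over `σ : Fin 2`
  simp only [Fin.sum_univ_two, hcoe, hone, Complex.exp_ofReal_mul_I_re, Complex.exp_ofReal_mul_I_im,
    Complex.one_re, Complex.one_im, sub_self, mul_zero, zero_mul, add_zero] at h
  simp only [Fin.sum_univ_two]
  rw [sum_pricing_rearrange] at h
  linarith

/-! ### The Bloch margin: uniform twists priced against the flux landscape -/

/-- The sector energy of the pure torus in the sector `(N_L, 0)` is the flux envelope at zero flux.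
[folklore] -/
theorem fluxEnergy_zero_eq (U δ : ℝ) :
    fluxEnergy L U δ 0 =
      (hubbardTorus 2 L 1 U).minEnergyOn (szSector (2 * ⌊(1 - δ) * (L : ℝ) ^ 2 / 2⌋₊) 0) := by
  rw [fluxEnergy_eq, hubbardTorusFlux_zero]

/-- **Bloch margin, natural orientation**: for every unit vector `φ` of the sector `(N_L, S^z = 0)`,
`N_L = 2⌊(1−δ)L²/2⌋`, and every flux `Φ`, pricing `φ` with the uniform twist `e^{iΦ/L}` on the
`e₁`-bonds gives
`[fluxEnergy(Φ) − fluxEnergy(0)] − (1 − cos(Φ/L)) K(φ) − sin(Φ/L) J̃(φ) ≤ Re⟨φ,Hφ⟩ − E₀`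
(`K`, `J̃` as in `uniformTwist_pricing`; the landscape term is the flux envelope of route
`FluxSpectroscopy` by `fluxEnergy_eq_minEnergyOn_uniformTwistConfig`). Bloch/Bohm (1949);
Watanabe (2019) §2.2.1; Tada–Koma (2016) §2. -/
theorem blochMargin' (hL : 3 ≤ L) (U δ Φ : ℝ) (φ : Fock (Orb (FermionTorus 2 L)))
    (hφ : φ ∈ szSector (2 * ⌊(1 - δ) * (L : ℝ) ^ 2 / 2⌋₊) 0) (h1 : star φ ⬝ᵥ φ = 1) :
    (fluxEnergy L U δ Φ - fluxEnergy L U δ 0)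
      - (1 - Real.cos (Φ / L)) *
          (∑ x : Site 2 L, ∑ σ : Fin 2, 2 * (star φ ⬝ᵥ ((creation
            (orb (FermionTorus.ofTorusSite (Site.shift x 0)) σ) *
              annihilation (orb (FermionTorus.ofTorusSite x) σ)) *ᵥ φ)).re)
      - Real.sin (Φ / L) *
          (∑ x : Site 2 L, ∑ σ : Fin 2, 2 * (star φ ⬝ᵥ ((creation
            (orb (FermionTorus.ofTorusSite (Site.shift x 0)) σ) *
              annihilation (orb (FermionTorus.ofTorusSite x) σ)) *ᵥ φ)).im) ≤
      (star φ ⬝ᵥ (hubbardTorus 2 L 1 U *ᵥ φ)).re -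
        (hubbardTorus 2 L 1 U).minEnergyOn (szSector (2 * ⌊(1 - δ) * (L : ℝ) ^ 2 / 2⌋₊) 0) := by
  rw [fluxEnergy_eq_minEnergyOn_uniformTwistConfig hL, fluxEnergy_zero_eq]
  exact uniformTwist_pricing hL U _ 0 Φ φ hφ h1

/-- **Bloch margin** (`BlochMargin` of the sketch, `hop` unfolded; the sketch's sign convention is
the twist `e^{−iΦ/L}`, equivalent by `fluxEnergy(−Φ) = fluxEnergy(Φ)`): for every unit vector `φ` of
the sector `(N_L, S^z = 0)` and every flux `Φ`,
`[fluxEnergy(Φ) − fluxEnergy(0)] − (1 − cos(Φ/L)) K(φ) + sin(Φ/L) J̃(φ) ≤ Re⟨φ,Hφ⟩ − E₀`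
(`K`, `J̃` as in `uniformTwist_pricing`). Bloch/Bohm (1949); Watanabe (2019) §2.2.1; Tada–Koma (2016) §2. -/
theorem blochMargin (hL : 3 ≤ L) (U δ Φ : ℝ) (φ : Fock (Orb (FermionTorus 2 L)))
    (hφ : φ ∈ szSector (2 * ⌊(1 - δ) * (L : ℝ) ^ 2 / 2⌋₊) 0) (h1 : star φ ⬝ᵥ φ = 1) :
    (fluxEnergy L U δ Φ - fluxEnergy L U δ 0)
      - (1 - Real.cos (Φ / L)) *
          (∑ x : Site 2 L, ∑ σ : Fin 2, 2 * (star φ ⬝ᵥ ((creation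
            (orb (FermionTorus.ofTorusSite (Site.shift x 0)) σ) *
              annihilation (orb (FermionTorus.ofTorusSite x) σ)) *ᵥ φ)).re)
      + Real.sin (Φ / L) *
          (∑ x : Site 2 L, ∑ σ : Fin 2, 2 * (star φ ⬝ᵥ ((creation
            (orb (FermionTorus.ofTorusSite (Site.shift x 0)) σ) *
              annihilation (orb (FermionTorus.ofTorusSite x) σ)) *ᵥ φ)).im) ≤
      (star φ ⬝ᵥ (hubbardTorus 2 L 1 U *ᵥ φ)).re -
        (hubbardTorus 2 L 1 U).minEnergyOn (szSector (2 * ⌊(1 - δ) * (L : ℝ) ^ 2 / 2⌋₊) 0) := by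
  have h := blochMargin' hL U δ (-Φ) φ hφ h1
  rw [fluxEnergy_neg, neg_div, Real.cos_neg, Real.sin_neg] at h
  linarith

/-- **Current costs energy quadratically, up to the paramagnetic deficit** (the optimised Bloch
margin): if the flux landscape of the sector `(N_L, 0)` dips below its zero-flux value by at most
`D` (`fluxEnergy(0) − fluxEnergy(Φ) ≤ D` for all `Φ`; `D = 0` is ground-state diamagnetism), then
every unit sector vector `φ` pays `√(K(φ)² + J̃(φ)²) − K(φ) − D ≤ Re⟨φ,Hφ⟩ − E₀` — at fixed kinetic
weight `K > 0` this is `≈ J̃²/2K − D`. (Optimise `blochMargin'` over the twist: `Φ/L = arg(K − iJ̃)`.)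
Bohm, Phys. Rev. 75 (1949) 502; Watanabe (2019) §2.2.1. -/
theorem sqrt_sq_add_sq_sub_le_of_fluxDeficit (hL : 3 ≤ L) (U δ D : ℝ)
    (hD : ∀ Φ : ℝ, fluxEnergy L U δ 0 - fluxEnergy L U δ Φ ≤ D)
    (φ : Fock (Orb (FermionTorus 2 L)))
    (hφ : φ ∈ szSector (2 * ⌊(1 - δ) * (L : ℝ) ^ 2 / 2⌋₊) 0) (h1 : star φ ⬝ᵥ φ = 1) :
    Real.sqrt ((∑ x : Site 2 L, ∑ σ : Fin 2, 2 * (star φ ⬝ᵥ ((creation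
            (orb (FermionTorus.ofTorusSite (Site.shift x 0)) σ) *
              annihilation (orb (FermionTorus.ofTorusSite x) σ)) *ᵥ φ)).re) ^ 2 +
        (∑ x : Site 2 L, ∑ σ : Fin 2, 2 * (star φ ⬝ᵥ ((creation
            (orb (FermionTorus.ofTorusSite (Site.shift x 0)) σ) *
              annihilation (orb (FermionTorus.ofTorusSite x) σ)) *ᵥ φ)).im) ^ 2)
      - (∑ x : Site 2 L, ∑ σ : Fin 2, 2 * (star φ ⬝ᵥ ((creation
            (orb (FermionTorus.ofTorusSite (Site.shift x 0)) σ) *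
              annihilation (orb (FermionTorus.ofTorusSite x) σ)) *ᵥ φ)).re) - D ≤
      (star φ ⬝ᵥ (hubbardTorus 2 L 1 U *ᵥ φ)).re -
        (hubbardTorus 2 L 1 U).minEnergyOn (szSector (2 * ⌊(1 - δ) * (L : ℝ) ^ 2 / 2⌋₊) 0) := by
  have hL0 : (L : ℝ) ≠ 0 := by exact_mod_cast (NeZero.ne L)
  set K : ℝ := ∑ x : Site 2 L, ∑ σ : Fin 2, 2 * (star φ ⬝ᵥ ((creation
            (orb (FermionTorus.ofTorusSite (Site.shift x 0)) σ) *
              annihilation (orb (FermionTorus.ofTorusSite x) σ)) *ᵥ φ)).re with hK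
  set J : ℝ := ∑ x : Site 2 L, ∑ σ : Fin 2, 2 * (star φ ⬝ᵥ ((creation
            (orb (FermionTorus.ofTorusSite (Site.shift x 0)) σ) *
              annihilation (orb (FermionTorus.ofTorusSite x) σ)) *ᵥ φ)).im with hJ
  -- the optimal twist angle `α = arg (K − iJ)`: `cos α = K/R`, `sin α = −J/R`, `R = √(K² + J²)`
  set z : ℂ := ⟨K, -J⟩ with hz
  have hvar : 0 ≤ (star φ ⬝ᵥ (hubbardTorus 2 L 1 U *ᵥ φ)).re -
      (hubbardTorus 2 L 1 U).minEnergyOn (szSector (2 * ⌊(1 - δ) * (L : ℝ) ^ 2 / 2⌋₊) 0) :=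
    sub_nonneg.2 (minEnergyOn_le_rayleigh_of_mem (isHermitian_hubbardTorus_one U) _ hφ h1)
  have hD0 : 0 ≤ D := by simpa using hD 0
  have hnorm : ‖z‖ = Real.sqrt (K ^ 2 + J ^ 2) := by
    rw [Complex.norm_eq_sqrt_sq_add_sq]; simp [hz]
  by_cases hz0 : z = 0
  · have hK0 : K = 0 := by simpa [hz] using congrArg Complex.re hz0
    have hJ0 : J = 0 := by simpa [hz] using congrArg Complex.im hz0
    rw [hK0, hJ0]
    simp only [ne_eq, OfNat.ofNat_ne_zero, not_false_eq_true, zero_pow, add_zero, Real.sqrt_zero,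
      sub_zero, zero_sub]
    linarith
  · have hcos : Real.cos (Complex.arg z) = K / ‖z‖ := by rw [Complex.cos_arg hz0]
    have hsin : Real.sin (Complex.arg z) = -J / ‖z‖ := by rw [Complex.sin_arg]
    have hpos : 0 < ‖z‖ := norm_pos_iff.2 hz0
    have h := blochMargin' hL U δ (L * Complex.arg z) φ hφ h1
    rw [mul_div_cancel_left₀ _ hL0, hcos, hsin] at h
    have hDz := hD (L * Complex.arg z)
    -- `(K/R)·K + (J/R)·J = R`
    have hR : K / ‖z‖ * K - -J / ‖z‖ * J = ‖z‖ := by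
      field_simp
      rw [hnorm, Real.sq_sqrt (by positivity)]
      ring
    rw [← hnorm]
    nlinarith [hR, h, hDz]

/-- Sanity: the crux decl this file supports is in scope by name. -/
example : Prop := Summit.HubbardSuperconductivity.HubbardSuperconductivity.Theses.DeformationLadder.LowEnergyRigidity

end Summit.HubbardSuperconductivity.HubbardSuperconductivity.Theorems.LowEnergyRigidity.GaugeOrbit
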